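import Literature.MathematicalPhysics.QuantumFieldTheory.Balaban1983to89.B3Ineq211RegularTorus
import Literature.MathematicalPhysics.QuantumFieldTheory.King1986.ContinuumLimitStatements

/-!
# Route «BalabanUVNodes», node N15 = NE2 — THE KING-MODEL RUNG, PART Θ⁺: KING 1986 THEOREM 3.3 (3.6)–(3.8) **BY NAME AT A REGULAR
# BACKGROUND `A ≠ 0`**, `Ω = T_ε`, on the typer's schema `King1986.ContinuumLimit.Thm33Printed`, assembled BY NAME from the tree's proofs of
# [Ba1] Propositions 2.1–2.3 at a regular torus field (King p. 656: *«Theorem 3.3 is proved in [Ba 4]»*)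

Cell `pub-ymgap`, Track A (D-0062), seat `pub-ymgap-dag-n15-e` (R141 (C), s3 «King-model rung»), generation 21.  `bears_on: R4∕N15`;
`--supports stmt-QuantumFields-27366` (K3⁸, `--as helper`).  COUNT-NEUTRAL.  Namespace `Summit.QuantumFields.YangMills.BalabanUVNodes.N15KingModelRung.Curved`
(PART Θ = the `A = 0`, full-torus inhabitant `…N15KingModelThm33AtZeroField.thm33Printed_king_zeroField`, p627580).

THE PRINT.  [King1986] C. King, CMP **102** (1986) 649–677: Theorem 3.3 pp. 655–656 (PDF p0007 L36 – p0008 L12; verbatim in the docstring of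
`ContinuumLimit.Thm33Printed`), Definition 3.2 (3.5) p. 655 *«A is regular on Ω_η if |∂^η_μA_ν(x)| ≤ C(e(L^kε)^{2−d∕2})^{β−1}»*.  [Ba1] =
[Balaban1982Higgs1] CMP **85** (1982) 603–626, Props. 2.1–2.3 (2.23)–(2.38) pp. 610–612 (p. 610 L1 *«we will use the case Ω = T_ε only»*).

WHAT THIS FILE PROVES (0 `sorry`; the `def`s are dictionary plumbing for the King schema, no `Prop`-valued fact).
* §1 dictionary items on the (Higgs)₂,₃ carrier `HiggsLattice` (the typer's own carrier of (3.2) `SmallField32`): `suppK`, `sdistK` (`dist(x, supp f)` in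
  lattice steps, (1.3)) + `sdistK_le`∕`_nonneg`, `tdist_comm`, `blockNormK` (the `ℓ¹` entry norm `Σ_{i,i′}|X_{(x,i),(y,i′)}|` of the `N×N` block of a field
  operator in the coordinate basis `B1Eq230FluctCov.cb` — our reading of King's `|X(x, y)|` for matrix-valued kernels) + `_nonneg`∕`_le`, the CHOSEN contour
  `contourK y x` (p26's admissible staircase `B3Ineq211RegularTorus.exists_isAdm`: a chain of torus bonds from `y` to `x` with `|Γ| ≤ d·|y − x|`; [Ba1] p. 610
  *«Γ_{x,x′} a shortest contour»*, King's coordinate contours (2.12)) + `contourK_spec`.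
* §2 ★ **`kingThm33DataReg C P k A a m²`** : `Thm33Data P.d (Site P k) (Site P 0) (EuclideanSpace ℝ (Fin N))` — THE DATUM OF THEOREM 3.3 AT THE FIELD `A`
  ON `Ω = T_ε`, level `k` (`η = L^{−k}`): `distk` = (1.3) on `T^{(k)}` (lattice units), `distη` = (1.3) on `T_ε` divided by `L^k`, `dsupp`, `dsupp2 = min`,
  `supNorm = ‖·‖_∞`, `transport y x = U(A(Γ_{y,x})) = B1TorusChainTransport.hol C A y (contourK y x)`, `lapK = (L^kε)²·‖Δ^{(k),L^kε}(T_ε, A)(x, y)‖₁`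
  (r14's `deltaKA`; King's `Δ^{(k)}(T, A)` by (2.22)), `covK = (L^kε)^{−2}·‖C^{(k),L^kε}(T_ε, A)(x, y)‖₁` (`condCov232` at `Λ = T^{(k)}`; (2.30)∕(2.31)),
  `G f = (L^kε)^{−2}·G^ε_k(T_ε, A)f` (`propagatorK`; (2.20)∕(2.22)), `DG μ f x = (L^kε)^{−1}·(D^ε_{A,μ}G^ε_kf)(⟨x, μ⟩)` (`covDeriv`); the `δ`-operators and the three
  boundary distances are `0` (`Ω = T`, `kingThm33DataReg_delta_zero`) — p35's reading of (2.26) at `Ω = Ω₀ = T_ε`.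
* §3 ★★★ **`thm33Printed_king_regularField`**: for `L` odd `> 1`, `a, m² > 0`, `N`, `(e, q)` there are `K₀min` and thresholds `t(K₀) > 0` such that for every cube
  size `K₀ ≥ K₀min`, every CUBIC torus of r14's sub-family (`Shape P`), `K₀ ∣ M`, `3K₀ ≤ 2M`, every level `1 ≤ k < K_P` with `L^kε ≤ 1`, and EVERY vector field
  `A` on `T_ε` with one-step differences `≤ δ` and THE ONE SMALLNESS `L^k·δ·|e| ≤ t(K₀)`: `Thm33Printed (kingThm33DataReg C P k A a m²)` — (3.6) ⇐ r14 g13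
  `B1Props21to23RegularTorus.ineq227_regular_torus` ∕ `ineq234_236_regular_torus_std` ([Ba1] (2.27), (2.34)); (3.7) ⇐ p35 g11 `B1Ineq225RegularTorus.
  norm_propagatorK_reg_decay` ∕ `norm_covDeriv_propagatorK_reg_decay` ((2.25)); (3.8) ⇐ `B1Ineq224RegularTorus.norm_holder_propagatorK_reg_decay` ((2.24)) at
  `α = ½` along the chosen contour; the four `δ`-clauses hold because their left sides vanish.  One `(δ₀, ½, C)` per `K₀` (min of five rates, a common
  constant, five thresholds merged).  Nothing of [Ba1]∕[Ba4] is re-proved.  `thm33Printed_king_regularField_zero`: at `A = 0` the hypotheses are met.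

THE REGULARITY CURRENCY.  (3.5) = [Ba1] (2.23) bounds the η-lattice gradient by a NEGATIVE power of the running charge; what the proofs use is «charge × field
gradient small» (*«for e(L^kε) sufficiently small»*).  The tree carries two spellings: p35's `(L^kε|e|∕e_k)|A_ν(x+εe_μ) − A_ν(x)| ≤ c·e_k^{β−1}∕L^k`, `e_k ≤ e₁` (any
normalisation `e_k > 0`) and r14's `|ΔA| ≤ δ`, `L^kδ|e| ≤ t`.  §3 takes r14's as THE hypothesis and feeds p35's theorems at `c = 1`, `β = 1`, `e_k := e₁(K₀)` (their condition
becomes `L^k·L^kε·|e|·δ ≤ e₁`, implied by `L^kδ|e| ≤ t ≤ e₁`, `L^kε ≤ 1`) — bookkeeping only, declared here.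

HONEST FRAMING ∕ SCOPE.  (i) A KNIT: King's Theorem 3.3 schema inhabited at LIVE regular backgrounds by Bałaban's own theorems already in the tree (lit-balaban
p35 g11, r14 g13, p26 g32); no estimate is new.  (ii) `Ω = T_ε` ONLY (King II p. 338: `∂Ω` = *«that part of the boundary of Ω which does not belong to ∂T_η»*, empty
here; the four `δ`-clauses are VACUOUS); sub-domains `Ω ⊊ T` = [Ba4] (1.11)–(1.12), in the tree as `B4ThmTorusBox` ∕ `B4ThmBoxPairEtaNoCollar`, NOT instantiated on this
carrier.  (iii) CUBIC tori (`Shape P`: equal periods), `L` odd `≥ 3`, `m² > 0`, `1 ≤ k < K_P`, `L^kε ≤ 1`; constants existential per cube size `K₀` («M sufficiently large»),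
weaker than the print's «depending on d, M only».  (iv) `|X(x, y)|` for the matrix kernels of (3.6) := `ℓ¹` entry norm of the `N×N` block; `U(A(Γ_{y,x}))` along ONE chosen
shortest-type staircase.  (v) `E = ℝ^N` (King's `U(1)`: `N = 2`), the orthogonal flow `U = exp(ηeA·q)` of `ChargeData`.  NOT Bałaban's non-abelian `G(U)` of [B9]; NE2⁺
NOT printed ∕ not proved; NOT a node discharge; counts untouched; nothing continuum ∕ ℝ⁴ ∕ OS ∕ mass-gap ∕ Clay.
-/

noncomputable section

open scoped BigOperators

namespace Summit.QuantumFields.YangMills.BalabanUVNodes.N15KingModelRung.Curved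

open Literature.MathematicalPhysics.QuantumFieldTheory.Balaban1983to89
open Literature.MathematicalPhysics.QuantumFieldTheory.Balaban1983to89.HiggsLattice (ChargeData covDeriv)
open Literature.MathematicalPhysics.QuantumFieldTheory.Balaban1983to89.HiggsCovariance (propagatorK)
open Literature.MathematicalPhysics.QuantumFieldTheory.Balaban1983to89.HiggsCondCov232 (condCov232)
open Literature.MathematicalPhysics.QuantumFieldTheory.Balaban1983to89.B1Eq230FluctCov (mat Ix deltaKA)
open Literature.MathematicalPhysics.QuantumFieldTheory.Balaban1983to89.B1TorusChainTransport (IsTChain hol)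
open Literature.MathematicalPhysics.QuantumFieldTheory.Balaban1983to89.B4GaugeCovariance (pathEnd)
open Literature.MathematicalPhysics.QuantumFieldTheory.Balaban1983to89.B3Ineq211RegularTorus (IsAdm exists_isAdm one_le_tdist_of_ne')
open Literature.MathematicalPhysics.QuantumFieldTheory.Balaban1983to89.B1Eq211ZeroFieldTorus (Shape)
open Literature.MathematicalPhysics.QuantumFieldTheory.Balaban1983to89.B1Ineq225BackgroundTorus (three_half_le_sites)
open Literature.MathematicalPhysics.QuantumFieldTheory.Balaban1983to89.B1Ineq225RegularTorus (norm_propagatorK_reg_decay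
  norm_covDeriv_propagatorK_reg_decay)
open Literature.MathematicalPhysics.QuantumFieldTheory.Balaban1983to89.B1Ineq224RegularTorus (norm_holder_propagatorK_reg_decay)
open Literature.MathematicalPhysics.QuantumFieldTheory.Balaban1983to89.B1Props21to23RegularTorus (ineq227_regular_torus
  ineq234_236_regular_torus_std)
open Literature.MathematicalPhysics.QuantumFieldTheory.King1986.ContinuumLimit (Thm33Data Thm33Printed Decay36 Decay37 Holder38)

variable {N : ℕ}

/-! ## §1 Dictionary items on the (Higgs)₂,₃ carrier -/

section Dict

variable {P : HiggsLattice.Params}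

open Classical in
/-- `supp f ⊂ T^{(k)}` as a finite set of sites. [cite: King1986, Thm 3.3 (3.7) p.656 «dist(x, supp f)»] -/
def suppK {k : ℕ} (f : HiggsLattice.ScalarField P k N) : Finset (HiggsLattice.Site P k) := Finset.univ.filter fun z => f z ≠ 0

/-- `dist(x, supp f)` in lattice steps of `T^{(k)}` (the (1.3) torus distance of [Ba1]; `0` for `f = 0`). [cite: King1986, Thm 3.3 (3.7) p.656] -/
def sdistK {k : ℕ} (x : HiggsLattice.Site P k) (f : HiggsLattice.ScalarField P k N) : ℝ :=
  if h : (suppK f).Nonempty then (((suppK f).inf' h fun z => HiggsLattice.Site.tdist x z : ℕ) : ℝ) else 0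

/-- the support distance lies below the distance to every point of the support. [cite: King1986, Thm 3.3 (3.7) p.656] -/
theorem sdistK_le {k : ℕ} {x z : HiggsLattice.Site P k} {f : HiggsLattice.ScalarField P k N} (hz : f z ≠ 0) : sdistK x f ≤ (HiggsLattice.Site.tdist x z : ℝ) := by
  classical
  have hmem : z ∈ suppK f := by unfold suppK; exact Finset.mem_filter.2 ⟨Finset.mem_univ _, hz⟩
  have hne : (suppK f).Nonempty := ⟨z, hmem⟩
  unfold sdistK
  rw [dif_pos hne]
  exact_mod_cast Finset.inf'_le _ hmem

/-- the support distance is non-negative. [cite: King1986, Thm 3.3 (3.7) p.656] -/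
theorem sdistK_nonneg {k : ℕ} (x : HiggsLattice.Site P k) (f : HiggsLattice.ScalarField P k N) : 0 ≤ sdistK x f := by
  unfold sdistK; split_ifs <;> positivity

/-- the (1.3) torus distance is symmetric. [cite: Balaban1982Higgs1, (1.3) p.604] -/
theorem tdist_comm {k : ℕ} (x y : HiggsLattice.Site P k) : HiggsLattice.Site.tdist x y = HiggsLattice.Site.tdist y x := by
  unfold HiggsLattice.Site.tdist
  exact Finset.sup_congr rfl fun μ _ => min_comm _ _

/-- THE MATRIX NORM READING King's `|X(x, y)|` for an `N×N`-block-valued kernel: the `ℓ¹` entry norm `Σ_{i,i′}|X_{(x,i),(y,i′)}|` of the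
block `(x, y)` of a field operator in the coordinate basis `B1Eq230FluctCov.cb`. [cite: King1986, Thm 3.3 (3.6) p.656] -/
def blockNormK {k : ℕ} (T : HiggsLattice.ScalarField P k N →ₗ[ℝ] HiggsLattice.ScalarField P k N) (x y : HiggsLattice.Site P k) : ℝ :=
  ∑ i : Ix N, ∑ i' : Ix N, |mat T (x, i) (y, i')|

/-- the block norm is non-negative. [cite: King1986, Thm 3.3 (3.6) p.656] -/
theorem blockNormK_nonneg {k : ℕ} (T : HiggsLattice.ScalarField P k N →ₗ[ℝ] HiggsLattice.ScalarField P k N) (x y : HiggsLattice.Site P k) : 0 ≤ blockNormK T x y :=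
  Finset.sum_nonneg fun _ _ => Finset.sum_nonneg fun _ _ => abs_nonneg _

/-- an entrywise bound sums to a block bound with the factor `N²` (`= |Ix N|²`). [cite: King1986, Thm 3.3 (3.6) p.656] -/
theorem blockNormK_le {k : ℕ} (T : HiggsLattice.ScalarField P k N →ₗ[ℝ] HiggsLattice.ScalarField P k N) (x y : HiggsLattice.Site P k) {b : ℝ}
    (h : ∀ i i' : Ix N, |mat T (x, i) (y, i')| ≤ b) :
    blockNormK T x y ≤ (Fintype.card (Ix N) : ℝ) ^ 2 * b := by
  unfold blockNormK
  calc ∑ i : Ix N, ∑ i' : Ix N, |mat T (x, i) (y, i')| ≤ ∑ _i : Ix N, ∑ _i' : Ix N, b :=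
        Finset.sum_le_sum fun i _ => Finset.sum_le_sum fun i' _ => h i i'
    _ = (Fintype.card (Ix N) : ℝ) ^ 2 * b := by
        rw [Finset.sum_const, Finset.sum_const, Finset.card_univ, nsmul_eq_mul, nsmul_eq_mul]; ring

/-- THE CHOSEN CONTOUR `Γ_{y,x}` from `y` to `x` on `T_ε`: p26's admissible nearest-neighbour staircase (a chain of torus bonds from `y`
ending at `x` with `|Γ| ≤ d·|y − x|`; King's coordinate contours (2.12), [Ba1] p. 610 «a shortest contour connecting these points»).
[cite: King1986, (2.12) p.653, Thm 3.3 (3.8) p.656] [cite: Balaban1982Higgs1, Prop. 2.1 p.610] -/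
def contourK (y x : HiggsLattice.Site P 0) : List (HiggsLattice.Site P 0) := Classical.choose (exists_isAdm y x)

/-- the chosen contour is admissible: a nearest-neighbour chain from `y` to `x` of length `≤ d·|y − x|`. [cite: Balaban1982Higgs1, Prop. 2.1 p.610] -/
theorem contourK_spec (y x : HiggsLattice.Site P 0) : IsAdm y x (contourK y x) := Classical.choose_spec (exists_isAdm y x)

end Dict

/-! ## §2 The datum of Theorem 3.3 at a regular field `A` on `Ω = T_ε` -/

/-- ★ **THE DATUM OF KING's THEOREM 3.3 AT THE VECTOR FIELD `A` ON `Ω = T_ε`, LEVEL `k`** (`η = L^{−k}`; dictionary in the module docstring §2: unit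
lattice `T^{(k)}` and fine lattice `T_ε` with their (1.3) distances, the latter in `η`-units; transports along the chosen contours; `Δ^{(k)}`, `C^{(k)}`,
`G_k`, `D^η_AG_k` by the rescalings (2.22)∕(2.31)∕(2.20) of r14's∕the typer's operators; boundary distances and `δ`-operators `0`).
[cite: King1986, Thm 3.3 (3.6)–(3.8) pp.655–656, (2.13)–(2.16) p.653, (2.20) p.654] [cite: Balaban1982Higgs1, (2.20)–(2.22) p.610, (2.30)–(2.31) p.611] -/
def kingThm33DataReg (C : ChargeData N) (P : HiggsLattice.Params) (k : ℕ) (A : HiggsLattice.VecField P 0) (a msq : ℝ) :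
    Thm33Data P.d (HiggsLattice.Site P k) (HiggsLattice.Site P 0) (EuclideanSpace ℝ (Fin N)) where
  distk x y := (HiggsLattice.Site.tdist x y : ℝ)
  distη x y := (HiggsLattice.Site.tdist x y : ℝ) / (P.L : ℝ) ^ k
  dsupp f x := sdistK x f / (P.L : ℝ) ^ k
  dsupp2 f x y := min (sdistK x f) (sdistK y f) / (P.L : ℝ) ^ k
  dbdryk _ _ := 0
  dbdryη _ _ := 0
  dsuppbdry _ := 0
  supNorm f := ‖f‖
  transport y x := hol C A y (contourK y x)
  lapK x y := P.mesh k ^ 2 * blockNormK (deltaKA C Finset.univ A msq a k) x y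
  covK x y := (P.mesh k ^ 2)⁻¹ * blockNormK (condCov232 C Finset.univ A msq a k Finset.univ) x y
  δcovK _ _ := 0
  G f := fun x => (P.mesh k ^ 2)⁻¹ • propagatorK C Finset.univ A msq a k f x
  DG μ f := fun x => (P.mesh k)⁻¹ • covDeriv C A (propagatorK C Finset.univ A msq a k f) ⟨x, μ⟩
  δG _ := 0
  δDG _ _ := 0

/-- On `Ω = T` the `δ`-operators and the three boundary distances of the datum vanish — the four `δ`-clauses of Theorem 3.3 are vacuous here.
[cite: King1986, Thm 3.3 p.656 «δC^{(k)}(Ω, A) = C^{(k)}(Ω, A) − C^{(k)}(A)»] [cite: Balaban1982Higgs1, (2.26) p.610, p.610 L1 «we will use the case Ω = T_ε only»] -/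
theorem kingThm33DataReg_delta_zero (C : ChargeData N) (P : HiggsLattice.Params) (k : ℕ) (A : HiggsLattice.VecField P 0) (a msq : ℝ) :
    (kingThm33DataReg C P k A a msq).δcovK = (fun _ _ => 0) ∧ (kingThm33DataReg C P k A a msq).δG = (fun _ => 0) ∧
      (kingThm33DataReg C P k A a msq).δDG = (fun _ _ => 0) ∧ (kingThm33DataReg C P k A a msq).dbdryk = (fun _ _ => 0) ∧
      (kingThm33DataReg C P k A a msq).dbdryη = (fun _ _ => 0) ∧ (kingThm33DataReg C P k A a msq).dsuppbdry = (fun _ => 0) :=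
  ⟨rfl, rfl, rfl, rfl, rfl, rfl⟩

/-! ## §3 Theorem 3.3 BY NAME at a regular field -/

/-- exponential weights compare: `c ≤ c′`, `δ′ ≤ δ`, `s, M ≥ 0` ⇒ `c·e^{−δs}·M ≤ c′·e^{−δ′s}·M`. [folklore] -/
private theorem weight_mono {c c' δ δ' s M : ℝ} (hc : c ≤ c') (hc' : 0 ≤ c') (hδ : δ' ≤ δ) (hs : 0 ≤ s) (hM : 0 ≤ M) :
    c * Real.exp (-(δ * s)) * M ≤ c' * Real.exp (-(δ' * s)) * M := by
  have h1 : Real.exp (-(δ * s)) ≤ Real.exp (-(δ' * s)) := Real.exp_le_exp.2 (by nlinarith)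
  have h2 : c * Real.exp (-(δ * s)) ≤ c' * Real.exp (-(δ' * s)) :=
    (mul_le_mul_of_nonneg_right hc (Real.exp_nonneg _)).trans (mul_le_mul_of_nonneg_left h1 hc')
  exact mul_le_mul_of_nonneg_right h2 hM

/-- the same without the trailing factor. [folklore] -/
private theorem weight_mono' {c c' δ δ' s : ℝ} (hc : c ≤ c') (hc' : 0 ≤ c') (hδ : δ' ≤ δ) (hs : 0 ≤ s) :
    c * Real.exp (-(δ * s)) ≤ c' * Real.exp (-(δ' * s)) := by simpa using weight_mono (M := 1) hc hc' hδ hs zero_le_one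

set_option maxHeartbeats 400000 in
/-- ★★★ **KING 1986 THEOREM 3.3 BY NAME AT A REGULAR BACKGROUND `A ≠ 0`, `Ω = T_ε`** (statement and sources in the module docstring §3): for every cube
size `K₀ ≥ K₀min`, every cubic torus of r14's sub-family with `K₀ ∣ M`, `3K₀ ≤ 2M`, every level `1 ≤ k < K_P` with `L^kε ≤ 1` and every field `A` on `T_ε` with
one-step differences `≤ δ`, `L^k·δ·|e| ≤ t(K₀)`: `Thm33Printed (kingThm33DataReg C P k A a m²)`, `α = ½`. [cite: King1986, Thm 3.3 (3.6)–(3.8) pp.655–656, Def. 3.2 (3.5) p.655]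
[cite: Balaban1982Higgs1, Prop. 2.1 (2.23)–(2.26) p.610, Prop. 2.2 (2.27) p.611, Prop. 2.3 (2.34) p.611] [cite: Balaban1983RegularityDecay, Theorem (1.9)–(1.12) p.573] -/
theorem thm33Printed_king_regularField (d L : ℕ) (hL : Odd L ∧ 1 < L) {a msq : ℝ} (ha : 0 < a) (hmsq : 0 < msq)
    (N : ℕ) (C : ChargeData N) :
    ∃ K₀min : ℕ, ∃ t : ℕ → ℝ, (∀ K₀, 0 < t K₀) ∧ ∀ K₀ : ℕ, K₀min ≤ K₀ →
      ∀ (P : HiggsLattice.Params) (_S : Shape P), P.d = d → P.L = L → K₀ ∣ P.M → 3 * K₀ ≤ 2 * P.M →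
      ∀ {k : ℕ}, 1 ≤ k → k < P.K → P.mesh k ≤ 1 →
      ∀ (A : HiggsLattice.VecField P 0) {δ : ℝ}, 0 ≤ δ →
        (∀ (z : HiggsLattice.Site P 0) (μ ν : Fin P.d), |A ⟨z.shift ν, μ⟩ - A ⟨z, μ⟩| ≤ δ) →
        (P.L : ℝ) ^ k * δ * |C.e| ≤ t K₀ →
        Thm33Printed (kingThm33DataReg C P k A a msq) := by
  have hL2 : 2 ≤ L := hL.2
  -- the five inputs: (2.25) value and derivative, (2.24) Hölder (p35 g11, at `c = 1`, `β = 1`), (2.27), (2.34) (r14 g13)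
  obtain ⟨cV, hcV, K₁, eV, δV, hVpos, hV⟩ := norm_propagatorK_reg_decay d L hL2 ha hmsq N C 1 1 1 zero_le_one one_pos
  obtain ⟨cD, hcD, K₂, eD, δD, hDpos, hD⟩ := norm_covDeriv_propagatorK_reg_decay d L hL2 ha hmsq N C 1 1 1 zero_le_one one_pos
  obtain ⟨K₃, hH0⟩ := norm_holder_propagatorK_reg_decay d L hL2 ha hmsq N C 1 1 1 zero_le_one one_pos
  obtain ⟨cH, hcH, eH, δH, hHpos, hH⟩ := hH0 (α := 1 / 2) (by norm_num) (by norm_num)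
  obtain ⟨cΔ, hcΔ, K₄, eΔ, δΔ, hΔpos, hΔ⟩ := ineq227_regular_torus d L hL ha hmsq N C 1
  obtain ⟨K₅, tC, cC, δC, hCpos, hCov⟩ := ineq234_236_regular_torus_std d L hL ha hmsq N C
  refine ⟨max (max K₁ K₂) (max K₃ (max K₄ K₅)),
    fun K₀ => min (eV K₀) (min (eD K₀) (min (eH K₀) (min (eΔ K₀) (tC K₀)))),
    fun K₀ => lt_min (hVpos K₀).1 (lt_min (hDpos K₀).1 (lt_min (hHpos K₀).1 (lt_min (hΔpos K₀).1 (hCpos K₀).1))), ?_⟩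
  intro K₀ hK₀ P S hPd hPL hK₀M h3M k hk1 hkK hs A δ hδ hreg ht
  obtain ⟨⟨hK₁, hK₂⟩, hK₃, hK₄, hK₅⟩ : (K₁ ≤ K₀ ∧ K₂ ≤ K₀) ∧ K₃ ≤ K₀ ∧ K₄ ≤ K₀ ∧ K₅ ≤ K₀ := by
    simp only [max_le_iff] at hK₀; exact ⟨⟨hK₀.1.1, hK₀.1.2⟩, hK₀.2.1, hK₀.2.2.1, hK₀.2.2.2⟩
  have htV : (P.L : ℝ) ^ k * δ * |C.e| ≤ eV K₀ := ht.trans (min_le_left _ _)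
  have htD : (P.L : ℝ) ^ k * δ * |C.e| ≤ eD K₀ := ht.trans ((min_le_right _ _).trans (min_le_left _ _))
  have htH : (P.L : ℝ) ^ k * δ * |C.e| ≤ eH K₀ :=
    ht.trans ((min_le_right _ _).trans ((min_le_right _ _).trans (min_le_left _ _)))
  have htΔ : (P.L : ℝ) ^ k * δ * |C.e| ≤ eΔ K₀ :=
    ht.trans ((min_le_right _ _).trans ((min_le_right _ _).trans ((min_le_right _ _).trans (min_le_left _ _))))
  have htC : (P.L : ℝ) ^ k * δ * |C.e| ≤ tC K₀ :=
    ht.trans ((min_le_right _ _).trans ((min_le_right _ _).trans ((min_le_right _ _).trans (min_le_right _ _))))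
  have hLpos : (0 : ℝ) < (P.L : ℝ) := by exact_mod_cast P.hL
  have hLk : (0 : ℝ) < (P.L : ℝ) ^ k := pow_pos hLpos k
  have hmesh : 0 < P.mesh k := P.mesh_pos k
  have hmesh0 : 0 < P.mesh 0 := P.mesh_pos 0
  have hmeshk : P.mesh k = (P.L : ℝ) ^ k * P.mesh 0 := by unfold HiggsLattice.Params.mesh; ring
  -- p35's regularity spelling at `c = 1`, `β = 1`, `e_k := e₁(K₀)`, from r14's one-parameter smallness
  have hreg35 : ∀ {e₁ : ℝ}, 0 < e₁ → (P.L : ℝ) ^ k * δ * |C.e| ≤ e₁ →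
      ∀ (x : HiggsLattice.Site P 0) (μ ν : Fin P.d),
        P.mesh k * |C.e| / e₁ * |A ⟨x.shift μ, ν⟩ - A ⟨x, ν⟩| ≤ 1 * e₁ ^ ((1 : ℝ) - 1) / (P.L : ℝ) ^ k := by
    intro e₁ he₁ hte x μ ν
    rw [sub_self, Real.rpow_zero, mul_one]
    have hA := hreg x ν μ
    have h1 : P.mesh k * |C.e| / e₁ * |A ⟨x.shift μ, ν⟩ - A ⟨x, ν⟩| ≤ P.mesh k * |C.e| / e₁ * δ :=
      mul_le_mul_of_nonneg_left hA (by positivity)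
    refine h1.trans ?_
    rw [div_mul_eq_mul_div, div_le_div_iff₀ he₁ hLk, one_mul]
    have h2 : P.mesh k * |C.e| * δ * (P.L : ℝ) ^ k = P.mesh k * ((P.L : ℝ) ^ k * δ * |C.e|) := by ring
    rw [h2]
    calc P.mesh k * ((P.L : ℝ) ^ k * δ * |C.e|) ≤ 1 * e₁ :=
          mul_le_mul hs hte (by positivity) zero_le_one
      _ = e₁ := one_mul _
  -- r14's (2.27) smallness: `(L^k)²·ε·|e|·δ = L^kδ|e|·L^kε ≤ e_Δ`
  have hsmallΔ : ((P.L : ℝ) ^ k) ^ 2 * P.mesh 0 * |C.e| * δ ≤ eΔ K₀ := by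
    have hu0 : 0 ≤ (P.L : ℝ) ^ k * δ * |C.e| := by positivity
    calc ((P.L : ℝ) ^ k) ^ 2 * P.mesh 0 * |C.e| * δ = ((P.L : ℝ) ^ k * δ * |C.e|) * P.mesh k := by rw [hmeshk]; ring
      _ ≤ ((P.L : ℝ) ^ k * δ * |C.e|) * 1 := mul_le_mul_of_nonneg_left hs hu0
      _ ≤ eΔ K₀ := by rw [mul_one]; exact htΔ
  -- the five instances
  have hV' := hV K₀ hK₁ P hPd hPL hK₀M h3M hk1 hkK.le hs A (hVpos K₀).1 le_rfl (hreg35 (hVpos K₀).1 htV)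
  have hD' := hD K₀ hK₂ P hPd hPL hK₀M h3M hk1 hkK.le hs A (hDpos K₀).1 le_rfl (hreg35 (hDpos K₀).1 htD)
  have hH' := hH K₀ hK₃ P hPd hPL hK₀M h3M hk1 hkK.le hs A (hHpos K₀).1 le_rfl (hreg35 (hHpos K₀).1 htH)
  have hΔ' := hΔ K₀ hK₄ P S hPd hPL hK₀M hk1 hkK.le (fun μ => three_half_le_sites hkK.le h3M μ) hs A hreg hsmallΔ
  have hC' := hCov K₀ hK₅ P S hPd hPL hK₀M h3M hk1 hkK hs A hδ hreg htC
  -- one set of constants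
  set n2 : ℝ := (Fintype.card (Ix N) : ℝ) ^ 2 with hn2
  have hn2nn : 0 ≤ n2 := by rw [hn2]; positivity
  set Cbig : ℝ := cV + cD + cH + n2 * cΔ + n2 * cC K₀ + 1 with hCbig
  have hcCpos := (hCpos K₀).2.1
  have hCbig0 : 0 < Cbig := by rw [hCbig]; positivity
  have hcV_le : cV ≤ Cbig := by rw [hCbig]; nlinarith [mul_nonneg hn2nn hcΔ.le, mul_nonneg hn2nn hcCpos.le]
  have hcD_le : cD ≤ Cbig := by rw [hCbig]; nlinarith [mul_nonneg hn2nn hcΔ.le, mul_nonneg hn2nn hcCpos.le]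
  have hcH_le : cH ≤ Cbig := by rw [hCbig]; nlinarith [mul_nonneg hn2nn hcΔ.le, mul_nonneg hn2nn hcCpos.le]
  have hcΔ_le : n2 * cΔ ≤ Cbig := by rw [hCbig]; nlinarith [mul_nonneg hn2nn hcCpos.le]
  have hcC_le : n2 * cC K₀ ≤ Cbig := by rw [hCbig]; nlinarith [mul_nonneg hn2nn hcΔ.le]
  set δ₀ : ℝ := min (δV K₀) (min (δD K₀) (min (δH K₀) (min (δΔ K₀) (δC K₀)))) with hδ₀
  have hδ₀pos : 0 < δ₀ :=
    lt_min (hVpos K₀).2 (lt_min (hDpos K₀).2 (lt_min (hHpos K₀).2 (lt_min (hΔpos K₀).2.1 (hCpos K₀).2.2)))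
  have hδV_le : δ₀ ≤ δV K₀ := min_le_left _ _
  have hδD_le : δ₀ ≤ δD K₀ := (min_le_right _ _).trans (min_le_left _ _)
  have hδH_le : δ₀ ≤ δH K₀ := (min_le_right _ _).trans ((min_le_right _ _).trans (min_le_left _ _))
  have hδΔ_le : δ₀ ≤ δΔ K₀ := (min_le_right _ _).trans ((min_le_right _ _).trans ((min_le_right _ _).trans (min_le_left _ _)))
  have hδC_le : δ₀ ≤ δC K₀ := (min_le_right _ _).trans ((min_le_right _ _).trans ((min_le_right _ _).trans (min_le_right _ _)))
  refine ⟨δ₀, 1 / 2, Cbig, hδ₀pos, by norm_num, by norm_num, ?_, ?_, ?_, ?_, ?_, ?_, ?_, ?_, ?_⟩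
  · -- (3.6) for `Δ^{(k)}(T, A)` ⇐ [Ba1] (2.27)
    intro x y
    show |P.mesh k ^ 2 * blockNormK (deltaKA C Finset.univ A msq a k) x y| ≤ Cbig * Real.exp (-(δ₀ * (HiggsLattice.Site.tdist x y : ℝ)))
    have hb := blockNormK_le (deltaKA C Finset.univ A msq a k) x y
      (b := cΔ * (P.mesh k)⁻¹ ^ 2 * Real.exp (-(δΔ K₀ * (HiggsLattice.Site.tdist x y : ℝ))))
      fun i i' => by simpa using hΔ' (x, i) (y, i')
    rw [abs_of_nonneg (mul_nonneg (sq_nonneg _) (blockNormK_nonneg _ _ _))]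
    have hs0 : 0 ≤ (HiggsLattice.Site.tdist x y : ℝ) := Nat.cast_nonneg _
    calc P.mesh k ^ 2 * blockNormK (deltaKA C Finset.univ A msq a k) x y
        ≤ P.mesh k ^ 2 * (n2 * (cΔ * (P.mesh k)⁻¹ ^ 2 * Real.exp (-(δΔ K₀ * (HiggsLattice.Site.tdist x y : ℝ))))) :=
          mul_le_mul_of_nonneg_left hb (sq_nonneg _)
      _ = n2 * cΔ * Real.exp (-(δΔ K₀ * (HiggsLattice.Site.tdist x y : ℝ))) := by field_simp
      _ ≤ Cbig * Real.exp (-(δ₀ * (HiggsLattice.Site.tdist x y : ℝ))) := weight_mono' hcΔ_le hCbig0.le hδΔ_le hs0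
  · -- (3.6) for `C^{(k)}(T, A)` ⇐ [Ba1] (2.34) at `Λ = T^{(k)}`
    intro x y
    show |(P.mesh k ^ 2)⁻¹ * blockNormK (condCov232 C Finset.univ A msq a k Finset.univ) x y|
        ≤ Cbig * Real.exp (-(δ₀ * (HiggsLattice.Site.tdist x y : ℝ)))
    have hb := blockNormK_le (condCov232 C Finset.univ A msq a k Finset.univ) x y
      (b := P.mesh k ^ 2 * cC K₀ * Real.exp (-(δC K₀ * (HiggsLattice.Site.tdist x y : ℝ))))
      fun i i' => by simpa using (hC' Finset.univ (p := (x, i)) (q := (y, i')) (Finset.mem_univ _) (Finset.mem_univ _)).1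
    rw [abs_of_nonneg (mul_nonneg (inv_nonneg.2 (sq_nonneg _)) (blockNormK_nonneg _ _ _))]
    have hs0 : 0 ≤ (HiggsLattice.Site.tdist x y : ℝ) := Nat.cast_nonneg _
    have hm2 : P.mesh k ^ 2 ≠ 0 := pow_ne_zero _ hmesh.ne'
    calc (P.mesh k ^ 2)⁻¹ * blockNormK (condCov232 C Finset.univ A msq a k Finset.univ) x y
        ≤ (P.mesh k ^ 2)⁻¹ * (n2 * (P.mesh k ^ 2 * cC K₀ * Real.exp (-(δC K₀ * (HiggsLattice.Site.tdist x y : ℝ))))) :=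
          mul_le_mul_of_nonneg_left hb (inv_nonneg.2 (sq_nonneg _))
      _ = n2 * cC K₀ * Real.exp (-(δC K₀ * (HiggsLattice.Site.tdist x y : ℝ))) := by field_simp
      _ ≤ Cbig * Real.exp (-(δ₀ * (HiggsLattice.Site.tdist x y : ℝ))) := weight_mono' hcC_le hCbig0.le hδC_le hs0
  · -- (3.7) for `G_k(T, A)` ⇐ [Ba1] (2.25), value member
    intro f x
    show ‖(P.mesh k ^ 2)⁻¹ • propagatorK C Finset.univ A msq a k f x‖
        ≤ Cbig * Real.exp (-(δ₀ * (sdistK x f / (P.L : ℝ) ^ k))) * ‖f‖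
    have hb := hV' f ‖f‖ (sdistK x f) (fun z => norm_le_pi_norm f z) (sdistK_nonneg x f) x (fun z hz => sdistK_le hz)
    rw [norm_smul, Real.norm_of_nonneg (inv_nonneg.2 (sq_nonneg _))]
    have hs0 : 0 ≤ sdistK x f / (P.L : ℝ) ^ k := div_nonneg (sdistK_nonneg x f) hLk.le
    have hm2 : P.mesh k ^ 2 ≠ 0 := pow_ne_zero _ hmesh.ne'
    calc (P.mesh k ^ 2)⁻¹ * ‖propagatorK C Finset.univ A msq a k f x‖
        ≤ (P.mesh k ^ 2)⁻¹ * (cV * P.mesh k ^ 2 * Real.exp (-(δV K₀ * (sdistK x f / (P.L : ℝ) ^ k))) * ‖f‖) :=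
          mul_le_mul_of_nonneg_left hb (inv_nonneg.2 (sq_nonneg _))
      _ = cV * Real.exp (-(δV K₀ * (sdistK x f / (P.L : ℝ) ^ k))) * ‖f‖ := by field_simp
      _ ≤ Cbig * Real.exp (-(δ₀ * (sdistK x f / (P.L : ℝ) ^ k))) * ‖f‖ := weight_mono hcV_le hCbig0.le hδV_le hs0 (norm_nonneg _)
  · -- (3.7) for `D^η_{A,μ}G_k(T, A)` ⇐ [Ba1] (2.25), derivative member
    intro μ f x
    show ‖(P.mesh k)⁻¹ • covDeriv C A (propagatorK C Finset.univ A msq a k f) ⟨x, μ⟩‖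
        ≤ Cbig * Real.exp (-(δ₀ * (sdistK x f / (P.L : ℝ) ^ k))) * ‖f‖
    have hb := hD' f ‖f‖ (sdistK x f) (fun z => norm_le_pi_norm f z) (sdistK_nonneg x f) ⟨x, μ⟩ (fun z hz => sdistK_le hz)
    rw [norm_smul, Real.norm_of_nonneg (inv_nonneg.2 hmesh.le)]
    have hs0 : 0 ≤ sdistK x f / (P.L : ℝ) ^ k := div_nonneg (sdistK_nonneg x f) hLk.le
    calc (P.mesh k)⁻¹ * ‖covDeriv C A (propagatorK C Finset.univ A msq a k f) ⟨x, μ⟩‖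
        ≤ (P.mesh k)⁻¹ * (cD * P.mesh k * Real.exp (-(δD K₀ * (sdistK x f / (P.L : ℝ) ^ k))) * ‖f‖) :=
          mul_le_mul_of_nonneg_left hb (inv_nonneg.2 hmesh.le)
      _ = cD * Real.exp (-(δD K₀ * (sdistK x f / (P.L : ℝ) ^ k))) * ‖f‖ := by field_simp
      _ ≤ Cbig * Real.exp (-(δ₀ * (sdistK x f / (P.L : ℝ) ^ k))) * ‖f‖ := weight_mono hcD_le hCbig0.le hδD_le hs0 (norm_nonneg _)
  · -- (3.8) ⇐ [Ba1] (2.24) at `α = ½` along the chosen contour `Γ_{y,x}`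
    intro μ f x y hxy
    show ((HiggsLattice.Site.tdist x y : ℝ) / (P.L : ℝ) ^ k) ^ (-(1 / 2 : ℝ)) *
          ‖hol C A y (contourK y x) ((P.mesh k)⁻¹ • covDeriv C A (propagatorK C Finset.univ A msq a k f) ⟨x, μ⟩)
            - (P.mesh k)⁻¹ • covDeriv C A (propagatorK C Finset.univ A msq a k f) ⟨y, μ⟩‖
        ≤ Cbig * Real.exp (-(δ₀ * (min (sdistK x f) (sdistK y f) / (P.L : ℝ) ^ k))) * ‖f‖
    obtain ⟨hch, hend, hlen⟩ := contourK_spec (P := P) y x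
    have hb := hH' f ‖f‖ (min (sdistK x f) (sdistK y f)) (fun z => norm_le_pi_norm f z)
      (le_min (sdistK_nonneg x f) (sdistK_nonneg y f)) μ y x hxy (contourK y x) hch hend hlen
      (fun z hz => (min_le_right _ _).trans (sdistK_le hz)) (fun z hz => (min_le_left _ _).trans (sdistK_le hz))
    set w := covDeriv C A (propagatorK C Finset.univ A msq a k f) with hw
    have hlin : hol C A y (contourK y x) ((P.mesh k)⁻¹ • w ⟨x, μ⟩) - (P.mesh k)⁻¹ • w ⟨y, μ⟩
        = (P.mesh k)⁻¹ • (hol C A y (contourK y x) (w ⟨x, μ⟩) - w ⟨y, μ⟩) := by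
      rw [ContinuousLinearMap.map_smul, smul_sub]
    rw [hlin, norm_smul, Real.norm_of_nonneg (inv_nonneg.2 hmesh.le)]
    have htpos : 0 < (HiggsLattice.Site.tdist x y : ℝ) / (P.L : ℝ) ^ k := by
      have h1 : (1 : ℝ) ≤ (HiggsLattice.Site.tdist x y : ℝ) := by
        have := one_le_tdist_of_ne' (P := P) (x := x) (x' := y) (Ne.symm hxy)
        exact_mod_cast this
      positivity
    have hpow : ((HiggsLattice.Site.tdist x y : ℝ) / (P.L : ℝ) ^ k) ^ (-(1 / 2 : ℝ))
        = (((HiggsLattice.Site.tdist y x : ℝ) / (P.L : ℝ) ^ k)⁻¹) ^ (1 / 2 : ℝ) := by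
      rw [tdist_comm y x, Real.rpow_neg htpos.le, Real.inv_rpow htpos.le]
    rw [hpow]
    have hs0 : 0 ≤ min (sdistK x f) (sdistK y f) / (P.L : ℝ) ^ k :=
      div_nonneg (le_min (sdistK_nonneg x f) (sdistK_nonneg y f)) hLk.le
    have hwpos : 0 ≤ (((HiggsLattice.Site.tdist y x : ℝ) / (P.L : ℝ) ^ k)⁻¹) ^ (1 / 2 : ℝ) := Real.rpow_nonneg (inv_nonneg.2 (by
      rw [tdist_comm y x]; exact htpos.le)) _
    calc (((HiggsLattice.Site.tdist y x : ℝ) / (P.L : ℝ) ^ k)⁻¹) ^ (1 / 2 : ℝ) * ((P.mesh k)⁻¹ * ‖hol C A y (contourK y x) (w ⟨x, μ⟩) - w ⟨y, μ⟩‖)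
        = (P.mesh k)⁻¹ * ((((HiggsLattice.Site.tdist y x : ℝ) / (P.L : ℝ) ^ k)⁻¹) ^ (1 / 2 : ℝ) *
            ‖hol C A y (contourK y x) (w ⟨x, μ⟩) - w ⟨y, μ⟩‖) := by ring
      _ ≤ (P.mesh k)⁻¹ * (cH * P.mesh k * Real.exp (-(δH K₀ * (min (sdistK x f) (sdistK y f) / (P.L : ℝ) ^ k))) * ‖f‖) :=
          mul_le_mul_of_nonneg_left hb (inv_nonneg.2 hmesh.le)
      _ = cH * Real.exp (-(δH K₀ * (min (sdistK x f) (sdistK y f) / (P.L : ℝ) ^ k))) * ‖f‖ := by field_simp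
      _ ≤ Cbig * Real.exp (-(δ₀ * (min (sdistK x f) (sdistK y f) / (P.L : ℝ) ^ k))) * ‖f‖ :=
          weight_mono hcH_le hCbig0.le hδH_le hs0 (norm_nonneg _)
  · -- `δC^{(k)}` clause: left side `0`
    intro x y
    show |(0 : ℝ)| ≤ Cbig * Real.exp (-(δ₀ * (HiggsLattice.Site.tdist x y : ℝ))) * Real.exp (-(δ₀ * 0))
    rw [abs_zero]; positivity
  · -- `δG_k` clause: left side `0`
    intro f x
    show ‖(0 : HiggsLattice.Site P 0 → EuclideanSpace ℝ (Fin N)) x‖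
        ≤ Cbig * Real.exp (-(δ₀ * (sdistK x f / (P.L : ℝ) ^ k))) * ‖f‖ * Real.exp (-(δ₀ * 0) - δ₀ * 0)
    rw [Pi.zero_apply, norm_zero]; positivity
  · -- `D^η_{A,μ}δG_k` clause: left side `0`
    intro μ f x
    show ‖(0 : HiggsLattice.Site P 0 → EuclideanSpace ℝ (Fin N)) x‖
        ≤ Cbig * Real.exp (-(δ₀ * (sdistK x f / (P.L : ℝ) ^ k))) * ‖f‖ * Real.exp (-(δ₀ * 0) - δ₀ * 0)
    rw [Pi.zero_apply, norm_zero]; positivity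
  · -- Hölder clause of `D^η_{A,μ}δG_k`: left side `0`
    intro μ f x y _hxy
    show ((HiggsLattice.Site.tdist x y : ℝ) / (P.L : ℝ) ^ k) ^ (-(1 / 2 : ℝ)) *
          ‖hol C A y (contourK y x) ((0 : HiggsLattice.Site P 0 → EuclideanSpace ℝ (Fin N)) x) - (0 : HiggsLattice.Site P 0 → EuclideanSpace ℝ (Fin N)) y‖
        ≤ Cbig * Real.exp (-(δ₀ * (min (sdistK x f) (sdistK y f) / (P.L : ℝ) ^ k))) * ‖f‖ * Real.exp (-(δ₀ * 0) - δ₀ * 0)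
    rw [Pi.zero_apply, Pi.zero_apply, map_zero, sub_zero, norm_zero, mul_zero]; positivity

/-- The hypotheses of `thm33Printed_king_regularField` are met below every threshold (at `A = 0`, `δ = 0`): the by-name inhabitant is not void; every
field with small enough one-step differences is admitted (the LIVE window). [cite: King1986, Def. 3.2 (3.5) p.655] -/
theorem thm33Printed_king_regularField_zero (d L : ℕ) (hL : Odd L ∧ 1 < L) {a msq : ℝ} (ha : 0 < a) (hmsq : 0 < msq)
    (N : ℕ) (C : ChargeData N) :
    ∃ K₀min : ℕ, ∀ K₀ : ℕ, K₀min ≤ K₀ →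
      ∀ (P : HiggsLattice.Params) (_S : Shape P), P.d = d → P.L = L → K₀ ∣ P.M → 3 * K₀ ≤ 2 * P.M →
      ∀ {k : ℕ}, 1 ≤ k → k < P.K → P.mesh k ≤ 1 →
        Thm33Printed (kingThm33DataReg C P k (0 : HiggsLattice.VecField P 0) a msq) := by
  obtain ⟨K₀min, t, ht, h⟩ := thm33Printed_king_regularField d L hL ha hmsq N C
  refine ⟨K₀min, fun K₀ hK₀ P S hPd hPL hK₀M h3M k hk1 hkK hs => ?_⟩
  refine h K₀ hK₀ P S hPd hPL hK₀M h3M hk1 hkK hs 0 (δ := 0) le_rfl (fun z μ ν => by simp) ?_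
  rw [mul_zero, zero_mul]; exact (ht K₀).le

end Summit.QuantumFields.YangMills.BalabanUVNodes.N15KingModelRung.Curved

end
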